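import Literature.Analysis.FluidPDE.ConstantinFeffermanStretching
import Literature.Analysis.FluidPDE.ConstantinFeffermanEnstrophySlab
import Literature.Analysis.FluidPDE.H1ContinuationSobolevClass
import HarnessLib

/-!
# Discharge of `constantin_fefferman` (**ns.S27**): the Constantin–Fefferman direction-of-vorticity
# regularity criterion for the 3-D Navier–Stokes equations

Analysis/FluidPDE proof file (theorems only, no definitions, no named facts). The named fact
`Literature.Analysis.FluidPDE.constantin_fefferman` of `NSVorticity.lean` (Constantin–Fefferman,
*Direction of vorticity and the problem of global regularity for the Navier–Stokes equations*,
Indiana Univ. Math. J. 42 (1993), 775–789, Theorem of §1: if `|sin φ(x, y, t)| ≤ |x − y|/ρ`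
whenever `|ω(x,t)|, |ω(y,t)| > Ω`, then the smooth solution stays regular on `[0, T]`) is now a
theorem: `constantin_fefferman_holds`.

## The proof (assembly of theorems of the tree)

* `exists_uniform_H1_bound_of_direction` (`ConstantinFeffermanEnstrophy.lean`) — the a priori
  bound: under the direction hypothesis `‖u(t)‖²_{L²} + ‖∇u(t)‖²_{L²}` stays bounded on `[0, T)`.
  Its ingredients are the geometric depletion of the stretching kernel
  (`VorticityDirectionDepletion.lean`), the smooth high/low splitting of the vorticity
  (`VorticityHighPart.lean`), the depleted kernel bound (`DepletedKernelBounds.lean`), the local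
  Helmholtz sup bound (`LocalHelmholtzSupBound.lean`), the fixed-time stretching estimate
  (`ConstantinFeffermanStretching.lean`), the vorticity energy identity, Tao's energy class and
  Grönwall's inequality — following Lemarié-Rieusset's proof of the (Beirão da Veiga–Berselli
  form of the) theorem, *The Navier–Stokes Problem in the 21st Century* (2016), Thm. 11.7, whose
  `½`-Hölder hypothesis is implied by Constantin–Fefferman's Lipschitz one (`min(1, s) ≤ √s`).
* `hasSobolevExtensionPast_of_uniform_H1_bound` (`H1ContinuationSobolevClass.lean`) — continuation
  in the Beale–Kato–Majda class from a uniform `H¹` bound (Tao's `H¹` local existence theorem,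
  uniqueness in the class, glue), which is how both sources conclude.

The original paper is a scanned document; the printed statement was checked against the theorem as
vendored in `NSVorticity.lean` and against Lemarié-Rieusset's exposition (§11.6, pp. 369–371 of the
PDF), which is the proof formalised.

## References

* P. Constantin, C. Fefferman, *Direction of vorticity and the problem of global regularity for
  the Navier–Stokes equations*, Indiana Univ. Math. J. 42 (1993), 775–789, Theorem (§1).
  [ConstantinFeffermanIndiana1993]
* P. G. Lemarié-Rieusset, *The Navier–Stokes Problem in the 21st Century*, CRC Press (2016),
  §11.6, Thm. 11.7 and its proof (PDF pp. 369–371). [LemarieRieusset2016]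
-/

noncomputable section

open MeasureTheory Set Function Filter Metric Real InnerProductSpace
open _root_.Topology
open scoped ENNReal NNReal RealInnerProductSpace ContDiff Laplacian

namespace Literature.Analysis.FluidPDE

-- nested operator types (second derivatives)
set_option maxSynthPendingDepth 3

/-! ### The uniform `H¹` bound -/

/-- **Constantin–Fefferman's a priori bound** (Indiana Univ. Math. J. 42 (1993), Theorem of §1, the
estimate of §2; Lemarié-Rieusset 2016, Thm. 11.7: "`u` does not blow up in `H¹`"). Let `ν > 0`,
`T > 0`, and let `(u, p)` be a classical unforced Navier–Stokes solution on `ℝ³ × [0, T)` with all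
`L²` Sobolev seminorms bounded on every `[0, T'']`, `T'' < T`. If the direction of the vorticity
satisfies `√(1 − ⟪ξ(x,t), ξ(y,t)⟫²) ≤ |x − y|/ρ` whenever `|ω(x,t)|, |ω(y,t)| > Ω` (`Ω, ρ > 0`),
then `‖u(t)‖²_{L²} + ‖∇u(t)‖²_{L²}` is bounded on `[0, T)`. Proof: Tao's energy class
(`tao_finite_energy_smooth_energy_bound_holds`) bounds the energy and the dissipation uniformly in
`T'' < T`; `integral_sq_norm_curl_le_of_direction_slab` (with the fixed-time estimate
`exists_two_mul_integral_stretching_le`) bounds the enstrophy `∫|ω(t)|²` uniformly; and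
`∫|∇u|² ≤ ∫|ω|²` (`lintegral_frobeniusNormSq_fderiv_le_lintegral_sq_norm_curl`). [cite: ConstantinFeffermanIndiana1993, Theorem (§1) and §2; LemarieRieusset2016, Thm. 11.7 (proof, PDF pp. 369–371); Tao2011, Lemma 8.1] -/
theorem exists_uniform_H1_bound_of_direction {ν T Ω ρ : ℝ} (hν : 0 < ν) (hT : 0 < T) (hΩ : 0 < Ω)
    (hρ : 0 < ρ) {u : ℝ → (EuclideanSpace ℝ (Fin 3)) → (EuclideanSpace ℝ (Fin 3))} {p : ℝ → (EuclideanSpace ℝ (Fin 3)) → ℝ}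
    (hsol : IsClassicalNSSolutionOn (Ico 0 T) ν 0 u p)
    (hreg : ∀ T'' < T, HasBoundedSobolevNormsOn (Icc 0 T'') u)
    (hdir : ∀ t ∈ Ico 0 T, ∀ x y : (EuclideanSpace ℝ (Fin 3)), Ω < ‖curl (u t) x‖ → Ω < ‖curl (u t) y‖ →
      Real.sqrt (1 - ⟪vorticityDirection (curl (u t)) x, vorticityDirection (curl (u t)) y⟫ ^ 2) ≤
        ‖x - y‖ / ρ) :
    ∃ A : ℝ, 0 ≤ A ∧ ∀ t ∈ Ico 0 T,
      (∫⁻ x, ‖u t x‖ₑ ^ 2) + (∫⁻ x, ENNReal.ofReal (frobeniusNormSq (fderiv ℝ (u t) x))) ≤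
        ENNReal.ofReal A := by
  obtain ⟨C, hCtop, hTao⟩ := tao_finite_energy_smooth_energy_bound_holds
  obtain ⟨C₁, C₂, C₃, C₄, hC₁, hC₂, hC₃, hC₄, hstr⟩ := exists_two_mul_integral_stretching_le hν hΩ hρ
  -- the initial energy and enstrophy
  have hreg0 : HasBoundedSobolevNormsOn (Icc 0 (T / 2)) u := hreg (T / 2) (by linarith)
  have h00 : (0 : ℝ) ∈ Icc 0 (T / 2) := ⟨le_rfl, by linarith⟩
  set E₀ : ℝ≥0∞ := ∫⁻ x, ‖u 0 x‖ₑ ^ 2 with hE₀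
  have hE₀top : E₀ < ⊤ := by
    obtain ⟨C0, hC0⟩ := hreg0 0
    refine lt_of_le_of_lt (le_of_eq (lintegral_congr fun x => ?_)) ((hC0 0 h00).trans_lt ENNReal.coe_lt_top)
    rw [← ofReal_norm, ← ofReal_norm, norm_iteratedFDeriv_zero]
  have hCE : C * E₀ < ⊤ := ENNReal.mul_lt_top hCtop hE₀top
  set Ē : ℝ := (C * E₀).toReal with hĒ
  have hĒ0 : 0 ≤ Ē := ENNReal.toReal_nonneg
  set I : ℝ := (C * E₀ / ENNReal.ofReal ν).toReal with hIdef
  have hI0 : 0 ≤ I := ENNReal.toReal_nonneg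
  set Y₀ : ℝ := ∫ x, ‖curl (u 0) x‖ ^ 2 with hY₀
  have hY₀0 : 0 ≤ Y₀ := integral_nonneg fun x => sq_nonneg _
  set Ystar : ℝ := (Y₀ + C₄ * I) * Real.exp ((C₁ + C₃ * Ē) * T + C₂ * (‖curlCLM‖ ^ 2 * I)) with hYstar
  have hYstar0 : 0 ≤ Ystar := by positivity
  refine ⟨Ē + Ystar, by positivity, ?_⟩
  intro t ht
  -- a closed slab containing `t`
  set T'' : ℝ := (t + T) / 2 with hT''def
  have htT'' : t < T'' := by rw [hT''def]; linarith [ht.2]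
  have hT''T : T'' < T := by rw [hT''def]; linarith [ht.2]
  have hT''pos : 0 < T'' := lt_of_le_of_lt ht.1 htT''
  have hS : IsClassicalNSSolutionOn (Icc 0 T'') ν 0 u p :=
    hsol.mono (Icc_subset_Ico_right hT''T) (uniqueDiffOn_Icc hT''pos)
  have hB : HasBoundedSobolevNormsOn (Icc 0 T'') u := hreg T'' hT''T
  have htS : t ∈ Icc 0 T'' := ⟨ht.1, htT''.le⟩
  -- Tao's energy class on the slab
  have hfe : ∃ A : ℝ≥0∞, A < ⊤ ∧ ∀ s ∈ Icc 0 T'', ∫⁻ x, ‖u s x‖ₑ ^ 2 ≤ A := by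
    obtain ⟨C0, hC0⟩ := hB 0
    refine ⟨C0, ENNReal.coe_lt_top, fun s hs => ?_⟩
    refine le_trans (le_of_eq (lintegral_congr fun x => ?_)) (hC0 s hs)
    rw [← ofReal_norm, ← ofReal_norm, norm_iteratedFDeriv_zero]
  obtain ⟨hen, hdiss⟩ := hTao ν T'' hν hT''pos u p hS hfe
  have hen' : ∀ s ∈ Icc 0 T'', ∫⁻ x, ‖u s x‖ₑ ^ 2 ≤ ENNReal.ofReal Ē := fun s hs => by
    rw [hĒ, ENNReal.ofReal_toReal hCE.ne]
    exact hen s hs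
  have hdiss' : ∫⁻ s in Ioo 0 T'', ∫⁻ x, ENNReal.ofReal (frobeniusNormSq (fderiv ℝ (u s) x)) ≤
      ENNReal.ofReal I := by
    have hν' : ENNReal.ofReal ν ≠ 0 := (ENNReal.ofReal_pos.2 hν).ne'
    have h1 : ∫⁻ s in Ioo 0 T'', ∫⁻ x, ENNReal.ofReal (frobeniusNormSq (fderiv ℝ (u s) x)) ≤
        C * E₀ / ENNReal.ofReal ν := by
      rw [ENNReal.le_div_iff_mul_le (Or.inl hν') (Or.inl ENNReal.ofReal_ne_top), mul_comm]
      exact hdiss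
    refine h1.trans (le_of_eq ?_)
    rw [hIdef, ENNReal.ofReal_toReal]
    exact (ENNReal.div_lt_top hCE.ne hν').ne
  -- the enstrophy bound on the slab
  have hstrS : ∀ s ∈ Icc 0 T'',
      2 * ∫ x, ⟪curl (u s) x, fderiv ℝ (u s) x (curl (u s) x)⟫ ≤
        ν * (∫ x, frobeniusNormSq (fderiv ℝ (curl (u s)) x)) +
          (C₁ + C₂ * (∫ x, ‖curl (u s) x‖ ^ 2) + C₃ * (∫ x, ‖u s x‖ ^ 2)) *
            (∫ x, ‖curl (u s) x‖ ^ 2) +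
          C₄ * (∫ x, frobeniusNormSq (fderiv ℝ (u s) x)) := by
    intro s hs
    have hsT : s ∈ Ico 0 T := ⟨hs.1, hs.2.trans_lt hT''T⟩
    have hv : ContDiff ℝ ∞ (u s) := hS.contDiff_velocity hs
    have hv4 : ContDiff ℝ 4 (u s) := hv.of_le (by norm_cast)
    have hv2 : ContDiff ℝ 2 (u s) := hv.of_le (by norm_cast)
    have hfin : ∀ n, ∫⁻ x, ‖iteratedFDeriv ℝ n (u s) x‖ₑ ^ 2 < ⊤ := fun n => by
      obtain ⟨Cn, hCn⟩ := hB n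
      exact (hCn s hs).trans_lt ENNReal.coe_lt_top
    have i0 : Integrable fun x => ‖u s x‖ ^ 2 :=
      integrable_sq_norm_of_lintegral_lt_top hv.continuous ((hen' s hs).trans_lt ENNReal.ofReal_lt_top)
    have i1 : Integrable fun x => ‖fderiv ℝ (u s) x‖ ^ 2 := by
      have h := integrable_sq_norm_of_lintegral_lt_top (hv4.continuous_iteratedFDeriv (by norm_num)) (hfin 1)
      exact h.congr (Eventually.of_forall fun x => by simp only [norm_iteratedFDeriv_one])
    have i2 : Integrable fun x => ‖fderiv ℝ (fderiv ℝ (u s)) x‖ ^ 2 := by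
      have h := integrable_sq_norm_of_lintegral_lt_top (hv4.continuous_iteratedFDeriv (by norm_num)) (hfin 2)
      refine h.congr (Eventually.of_forall fun x => ?_)
      show ‖iteratedFDeriv ℝ 2 (u s) x‖ ^ 2 = ‖fderiv ℝ (fderiv ℝ (u s)) x‖ ^ 2
      rw [← norm_iteratedFDeriv_fderiv, norm_iteratedFDeriv_one]
    obtain ⟨B₂, -, hB₂⟩ := exists_forall_norm_fderiv_fderiv_le_of_hasBoundedSobolevNormsOn
      (fun r hr => (hS.contDiff_velocity hr).of_le (by norm_cast)) hB
    exact hstr hv2 (hS.divFree s hs) i0 i1 i2 ⟨B₂, hB₂ s hs⟩ (hdir s hsT)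
  have hY := integral_sq_norm_curl_le_of_direction_slab hν hT''pos hS hB hĒ0 hI0 hen' hdiss'
    hC₁ hC₂ hC₃ hC₄ hstrS t htS
  have hYstar_le : ∫ x, ‖curl (u t) x‖ ^ 2 ≤ Ystar := by
    refine hY.trans ?_
    rw [hYstar]
    refine mul_le_mul_of_nonneg_left (Real.exp_le_exp.2 ?_) (by positivity)
    have : (C₁ + C₃ * Ē) * T'' ≤ (C₁ + C₃ * Ē) * T :=
      mul_le_mul_of_nonneg_left hT''T.le (by positivity)
    linarith
  -- the `H¹` quantity
  have hvt : ContDiff ℝ ∞ (u t) := hS.contDiff_velocity htS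
  have hcurl_int : Integrable fun x => ‖curl (u t) x‖ ^ 2 := by
    have hfin1 : ∫⁻ x, ‖iteratedFDeriv ℝ 1 (u t) x‖ₑ ^ 2 < ⊤ := by
      obtain ⟨C1, hC1⟩ := hB 1
      exact (hC1 t htS).trans_lt ENNReal.coe_lt_top
    refine integrable_sq_norm_of_lintegral_lt_top (continuous_curl (hvt.of_le (by norm_cast))) ?_
    exact lt_of_le_of_lt (lintegral_curl_sq_le (u t)) (ENNReal.mul_lt_top ENNReal.ofReal_lt_top hfin1)
  have hdc : ∫⁻ x, ENNReal.ofReal (frobeniusNormSq (fderiv ℝ (u t) x)) ≤ ENNReal.ofReal Ystar := by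
    refine (lintegral_frobeniusNormSq_fderiv_le_lintegral_sq_norm_curl
      (hvt.of_le (by norm_cast)) (hS.divFree t htS)
      ((hen' t htS).trans_lt ENNReal.ofReal_lt_top)).trans ?_
    rw [show (∫⁻ x, ‖curl (u t) x‖ₑ ^ 2) = ∫⁻ x, ENNReal.ofReal (‖curl (u t) x‖ ^ 2) from
      lintegral_congr fun x => by rw [← ofReal_norm, ENNReal.ofReal_pow (norm_nonneg _)],
      ← ofReal_integral_eq_lintegral_ofReal hcurl_int (Eventually.of_forall fun x => sq_nonneg _)]
    exact ENNReal.ofReal_le_ofReal hYstar_le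
  calc (∫⁻ x, ‖u t x‖ₑ ^ 2) + (∫⁻ x, ENNReal.ofReal (frobeniusNormSq (fderiv ℝ (u t) x)))
      ≤ ENNReal.ofReal Ē + ENNReal.ofReal Ystar := add_le_add (hen' t htS) hdc
    _ = ENNReal.ofReal (Ē + Ystar) := (ENNReal.ofReal_add hĒ0 hYstar0).symm

/-! ### The discharge -/

/-- **ns.S27, the Constantin–Fefferman criterion, discharged** (Constantin–Fefferman 1993,
Theorem of §1; proof along Lemarié-Rieusset 2016, Thm. 11.7): the uniform `H¹` bound under the
direction hypothesis (`exists_uniform_H1_bound_of_direction`) fed into the continuation principle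
from a uniform `H¹` bound (`hasSobolevExtensionPast_of_uniform_H1_bound`). [cite: ConstantinFeffermanIndiana1993, Theorem (§1); LemarieRieusset2016, Thm. 11.7 (PDF pp. 369–371)] -/
theorem constantin_fefferman_holds : constantin_fefferman := by
  intro ν hν T hT Ω ρ hΩ hρ u p hsol hreg hdir
  obtain ⟨A, hA0, hA⟩ := exists_uniform_H1_bound_of_direction hν hT hΩ hρ hsol hreg hdir
  exact hasSobolevExtensionPast_of_uniform_H1_bound hν hT hsol hreg hA0 hA

end Literature.Analysis.FluidPDE

end
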